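import Mathlib.Analysis.InnerProductSpace.Calculus
import Mathlib.Analysis.Calculus.Deriv.Mul
import Mathlib.Analysis.Calculus.Deriv.Add
import Literature.MathematicalPhysics.KineticTheory.HardSphereEuler
import Literature.Analysis.FunctionSpaces.TorusCalculusProofs
import Literature.Analysis.FunctionSpaces.TorusTestFunction
import HarnessLib

/-!
# Two-temperature compressible Euler equations with Landau–Teller relaxation (rough spheres)

Topic `Literature/MathematicalPhysics/KineticTheory` (item `defn-IsLandauTellerEulerSolution`, wanted by
route `RoughSpheresKappaDial` of `AtomisticToContinuum/HydrodynamicLimit`, item `LandauTellerWindow`).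

**The model.** A gas of perfectly rough elastic spheres (Bryan–Pidduck model, Chapman–Cowling Ch. 11)
carries translational *and* rotational kinetic energy, `3` quadratic degrees of freedom each. In a uniform
steady state they are equipartitioned (`N = 6`, `γ = 4/3`), but out of equilibrium "there is no guarantee
that `I ω̄² = m C̄²`" (Chapman–Cowling §11.4, footnote): the hydrodynamic description carries **two
temperatures** `θ_tr`, `θ_rot` relaxing towards each other at a collision frequency `ν` (rough spheres:
Pidduck 1922, Widom 1960, Condiff–Lu–Dahler 1965; the homogeneous law `dT_tr/dt = -ν(T_tr - T_rot)`,
`dT_rot/dt = ν(T_tr - T_rot)`, `ν ∝ κ(1+κ)⁻² n σ² g(σ) √T_tr`, is Huthmann–Zippelius 1997, eqs. (16)–(17)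
of the arXiv version at `ε = β = 1`). Coupled to inviscid transport (Chapman–Cowling Note B: Euler
energy equation with the rotational energy lagging) this is a hyperbolic system of balance laws with
relaxation in the sense of Chen–Levermore–Liu 1994, §1 (1.1); its local equilibrium `θ_tr = θ_rot` is the
one-temperature `γ = 4/3` Euler system, its frozen limit `ν = 0` hard-sphere (`γ = 5/3`) Euler for
`(ρ, u, θ_tr)` with `θ_rot` advected: `∂ₜρ + div(ρu) = 0`; `∂ₜ(ρu) + ∑ᵢ ∂ᵢ(ρuᵢu) + ∇p = 0`,
`p = hsPressure σ ρ θ_tr` (kinetic pressure, at the TRANSLATIONAL temperature: Chapman–Cowling keep the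
translational `T` "to ensure that the hydrostatic pressure should exactly equal `knT`");
`∂ₜE_tr + div((E_tr + p)u) = -(3/2)ρν(θ_tr - θ_rot)`, `E_tr = ρ(|u|²/2 + 3θ_tr/2)` (`totalEnergyDensity`);
`∂ₜ((3/2)ρθ_rot) + div((3/2)ρθ_rot u) = (3/2)ρν(θ_tr - θ_rot)`; `ρ, θ_tr, θ_rot > 0`; `ν = r · c(σ, ρ, θ_tr, θ_rot)`.

**Design.** Same style, torus calculus (`Torus.timeDerivWithin (Ico 0 T)`, `divergence`, `partialDeriv`,
`gradient`) and smoothness (`Torus.IsSmoothSpaceTimeOn (Ico 0 T)`: jointly `C^∞` on `[0,T) × 𝕋³`) as the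
accepted `IsHardSphereEulerSolution`, hard-sphere equation of state `hsPressure`. The RATE FUNCTION
`c : ℝ → ℝ → ℝ → ℝ → ℝ`, `(σ, ρ, θ_tr, θ_rot) ↦ c`, is a PARAMETER and `r` the window parameter
multiplying it; the physical identification of `c` (the `κ → 0` limit of `κ⁻¹ ×` the dilute rough-sphere
relaxation frequency times the contact value `Y(ρσ³)`) is deliberately NOT baked in (a separate statement
of the route), and no sign/regularity condition on `c` is imposed here.

**API.** `isHardSphereEulerSolution` (`r = 0` ⇒ `(ρ, u, θ_tr)` is an `IsHardSphereEulerSolution σ T`);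
`rotTemperature_convective` (`∂ₜθ_rot + ⟪u, ∇θ_rot⟫ = ν(θ_tr - θ_rot)`: rotational balance minus `θ_rot ×`
continuity, Leibniz rules, `ρ > 0`) and `rotTemperature_transport` (`r = 0` ⇒ `θ_rot` transported);
`totalEnergy_balance` (exchange terms cancel, every `r`) and `totalEnergy` (conservation form
`∂ₜ(E_tr + E_rot) + div((E_tr + E_rot + p)u) = 0` when the pressure field is `C¹` in space —
`hsCompressibility` is a `limsup`/`deriv`, so this is an honest hypothesis, automatic where the virial
equation of state is smooth); non-vacuity: `const` (global equilibria, any `c`) and `homogeneousRelaxation`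
(the explicit exponentially relaxing homogeneous two-temperature state — fixes the sign conventions).

## References

* S. Chapman, T. G. Cowling, *The Mathematical Theory of Non-uniform Gases*, CUP, 2nd ed. 1952 (repr. 1960;
  the held printing; 3rd ed. 1970 = [ChapmanCowling1970]), Ch. 11 "The rough spherical molecule": §11.2
  (collisions; `κ → 0` decoupling), §11.3 (transfer, `E = ½mC² + ½Iω²`), §11.4 + footnote (`N = 6` only in
  uniform steady states; `p = knT`); Note B (Kohler: rotational lag, relaxation). [ChapmanCowling1952]
* F. B. Pidduck, Proc. R. Soc. A 101 (1922) 101 [Pidduck1922]; B. Widom, J. Chem. Phys. 32 (1960) 913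
  [Widom1960]; D. W. Condiff, W.-K. Lu, J. S. Dahler, J. Chem. Phys. 42 (1965) 3445 [CondiffLuDahler1965]
* M. Huthmann, A. Zippelius, Phys. Rev. E 56 (1997) R6275, arXiv cond-mat/9708093, eqs. (16)–(17)
  (two-temperature rate equations for rough spheres). [HuthmannZippelius1997]
* G.-Q. Chen, C. D. Levermore, T.-P. Liu, CPAM 47 (1994) 787–830, §1 (1.1) (hyperbolic systems with
  relaxation, local equilibria, subcharacteristic condition). [ChenLevermoreLiu1994]
-/

noncomputable section

open MeasureTheory Filter Set
open _root_.Topology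
open scoped InnerProductSpace
open Literature.Analysis.FunctionSpaces
open Literature.Analysis.FunctionSpaces.Torus

namespace Literature.MathematicalPhysics.KineticTheory

/-- **Rotational energy density** `E_rot = (3/2) ρ θ_rot` of the rough-sphere gas at (normalised)
density `ρ` and rotational temperature `θ_rot`: three rotational quadratic degrees of freedom per
particle, `½ I Ω̄² = (3/2) k T` in equilibrium (Chapman–Cowling §11.4: mean peculiar energy `3kT`, of
which `(3/2)kT` translational). [cite: ChapmanCowling1952, §11.4] -/
def rotationalEnergyDensity (ρ θrot : ℝ) : ℝ :=
  3 / 2 * ρ * θrot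

/-- **Landau–Teller exchange rate** (energy per unit volume and time transferred from the
translational to the rotational degrees of freedom): `(3/2) ρ ν (θ_tr - θ_rot)` with exchange frequency
`ν = r · c(σ, ρ, θ_tr, θ_rot)` — window parameter `r` times a rate function `c` (a parameter; for rough
spheres `ν ∝ κ(1+κ)⁻² ρ σ² Y √θ_tr`, Huthmann–Zippelius, arXiv eqs. (16)–(17) at `ε = β = 1`).
[cite: HuthmannZippelius1997, eqs. (16)–(17) of arXiv cond-mat/9708093] -/
def landauTellerExchange (r : ℝ) (c : ℝ → ℝ → ℝ → ℝ → ℝ) (σ ρ θtr θrot : ℝ) : ℝ :=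
  3 / 2 * ρ * (r * c σ ρ θtr θrot) * (θtr - θrot)

/-- No exchange at window parameter `r = 0` (frozen rotational energy). [folklore] -/
@[simp]
theorem landauTellerExchange_zero_left (c : ℝ → ℝ → ℝ → ℝ → ℝ) (σ ρ θtr θrot : ℝ) :
    landauTellerExchange 0 c σ ρ θtr θrot = 0 := by
  simp [landauTellerExchange]

/-- No exchange in local equilibrium `θ_tr = θ_rot`. [folklore] -/
@[simp]
theorem landauTellerExchange_self (r : ℝ) (c : ℝ → ℝ → ℝ → ℝ → ℝ) (σ ρ θ : ℝ) :
    landauTellerExchange r c σ ρ θ θ = 0 := by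
  simp [landauTellerExchange]

/-! ### Classical solutions of the two-temperature Euler–Landau–Teller system on `𝕋³` -/

/-- **Classical solution of the two-temperature compressible Euler system with Landau–Teller
relaxation** for the rough-sphere gas at reduced diameter `σ`, window parameter `r` and rate function
`c` on `[0, T) × 𝕋³`: `ρ, u, θ_tr, θ_rot` jointly smooth on `[0,T) × 𝕋³` (`Torus.IsSmoothSpaceTimeOn`),
`ρ, θ_tr, θ_rot > 0`, and pointwise on `[0,T) × 𝕋³` (one-sided time derivative within `[0,T)`):
`∂ₜρ + div(ρu) = 0`; `∂ₜ(ρu) + ∑ᵢ ∂ᵢ(ρuᵢu) + ∇p = 0` with `p = hsPressure σ ρ θ_tr` (pressure at the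
TRANSLATIONAL temperature); `∂ₜE_tr + div((E_tr + p)u) = -(3/2)ρν(θ_tr - θ_rot)` with
`E_tr = ρ(|u|²/2 + 3θ_tr/2)`; `∂ₜ((3/2)ρθ_rot) + div((3/2)ρθ_rot u) = (3/2)ρν(θ_tr - θ_rot)`;
`ν = r · c(σ, ρ, θ_tr, θ_rot)`. The inviscid equations of transfer of the rough-sphere gas with the
rotational energy lagging behind the translational one (Chapman–Cowling §11.3, §11.4 footnote, Note B),
closed by the two-temperature rate law (Huthmann–Zippelius, arXiv (16)–(17)); a relaxation system in the
sense of Chen–Levermore–Liu 1994, §1 (1.1). [cite: ChapmanCowling1952, §11.3–11.4 (footnote) and Note B] -/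
structure IsLandauTellerEulerSolution (σ r : ℝ) (c : ℝ → ℝ → ℝ → ℝ → ℝ) (T : ℝ) (ρ : ℝ → T3 → ℝ)
    (u : ℝ → T3 → V3) (θtr θrot : ℝ → T3 → ℝ) : Prop where
  smooth_density : IsSmoothSpaceTimeOn (Ico 0 T) ρ
  smooth_velocity : IsSmoothSpaceTimeOn (Ico 0 T) u
  smooth_trTemperature : IsSmoothSpaceTimeOn (Ico 0 T) θtr
  smooth_rotTemperature : IsSmoothSpaceTimeOn (Ico 0 T) θrot
  density_pos : ∀ t ∈ Ico 0 T, ∀ x, 0 < ρ t x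
  trTemperature_pos : ∀ t ∈ Ico 0 T, ∀ x, 0 < θtr t x
  rotTemperature_pos : ∀ t ∈ Ico 0 T, ∀ x, 0 < θrot t x
  mass : ∀ t ∈ Ico 0 T, ∀ x,
    timeDerivWithin (Ico 0 T) ρ t x + divergence (fun y => ρ t y • u t y) x = 0
  momentum : ∀ t ∈ Ico 0 T, ∀ x,
    timeDerivWithin (Ico 0 T) (fun s y => ρ s y • u s y) t x +
      (∑ i, partialDeriv i (fun y => (ρ t y * u t y i) • u t y) x) +
      gradient (fun y => hsPressure σ (ρ t y) (θtr t y)) x = 0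
  trEnergy : ∀ t ∈ Ico 0 T, ∀ x,
    timeDerivWithin (Ico 0 T) (fun s y => totalEnergyDensity (ρ s y) (u s y) (θtr s y)) t x +
      divergence (fun y =>
        (totalEnergyDensity (ρ t y) (u t y) (θtr t y) + hsPressure σ (ρ t y) (θtr t y)) • u t y) x =
      -landauTellerExchange r c σ (ρ t x) (θtr t x) (θrot t x)
  rotEnergy : ∀ t ∈ Ico 0 T, ∀ x,
    timeDerivWithin (Ico 0 T) (fun s y => rotationalEnergyDensity (ρ s y) (θrot s y)) t x +
      divergence (fun y => rotationalEnergyDensity (ρ t y) (θrot t y) • u t y) x =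
      landauTellerExchange r c σ (ρ t x) (θtr t x) (θrot t x)

namespace IsLandauTellerEulerSolution

variable {σ r : ℝ} {c : ℝ → ℝ → ℝ → ℝ → ℝ} {T : ℝ} {ρ : ℝ → T3 → ℝ} {u : ℝ → T3 → V3}
  {θtr θrot : ℝ → T3 → ℝ}

/-- At window parameter `r = 0` (no translational–rotational exchange) the triple `(ρ, u, θ_tr)` of a
two-temperature solution is a classical solution of the hard-sphere compressible Euler system
(`IsHardSphereEulerSolution`). [folklore] -/
theorem isHardSphereEulerSolution (h : IsLandauTellerEulerSolution σ 0 c T ρ u θtr θrot) :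
    IsHardSphereEulerSolution σ T ρ u θtr where
  smooth_density := h.smooth_density
  smooth_velocity := h.smooth_velocity
  smooth_temperature := h.smooth_trTemperature
  density_pos := h.density_pos
  temperature_pos := h.trTemperature_pos
  mass := h.mass
  momentum := h.momentum
  energy t ht x := by simpa using h.trEnergy t ht x

/-! ### Leibniz rules used below (torus calculus, `C¹` data) -/

/-- `div(φ v) = Dφ[v] + φ div v` for `C¹` `φ`, `v` on `𝕋³`. [folklore] -/
theorem torusDivergence_smul_apply {φ : T3 → ℝ} {v : T3 → V3} (hφ : IsContDiff 1 φ) (hv : IsContDiff 1 v)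
    (x : T3) :
    divergence (fun y => φ y • v y) x = Torus.fderiv φ x (v x) + φ x * divergence v x := by
  have h1 : ∀ i, IsContDiff 1 (fun y => v y i) := fun i =>
    (EuclideanSpace.proj i : V3 →L[ℝ] ℝ).contDiff.comp hv
  have hcomp : ∀ i, (fun y => (φ y • v y) i) = fun y => φ y * v y i := fun i => by
    funext y; simp
  simp only [divergence, hcomp]
  simp_rw [partialDeriv_mul hφ (h1 _), Finset.sum_add_distrib, ← Finset.mul_sum]
  rw [fderiv_apply_eq_sum_partialDeriv hφ, add_comm]
  simp [smul_eq_mul, mul_comm]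

/-- `D(ab)[w] = a Db[w] + b Da[w]` for `C¹` scalar `a`, `b` on `𝕋³`. [folklore] -/
theorem torusFDeriv_mul_apply {a b : T3 → ℝ} (ha : IsContDiff 1 a) (hb : IsContDiff 1 b) (x : T3)
    (w : V3) :
    Torus.fderiv (fun y => a y * b y) x w = a x * Torus.fderiv b x w + b x * Torus.fderiv a x w := by
  have h := fderiv_smul_apply ha hb x w
  simp only [smul_eq_mul] at h
  rw [h]
  ring

/-- `D(a + b)[w] = Da[w] + Db[w]` for `C¹` `a`, `b` on `𝕋³`. [folklore] -/
theorem torusFDeriv_add_apply {a b : T3 → ℝ} (ha : IsContDiff 1 a) (hb : IsContDiff 1 b) (x : T3)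
    (w : V3) :
    Torus.fderiv (fun y => a y + b y) x w = Torus.fderiv a x w + Torus.fderiv b x w := by
  rw [show (fun y => a y + b y) = a + b from rfl, Torus.fderiv_add ha hb x]
  rfl

/-- The torus derivative of a constant vanishes. [folklore] -/
theorem torusFDeriv_const_apply (k : ℝ) (x : T3) (w : V3) :
    Torus.fderiv (fun _ : T3 => k) x w = 0 := by
  change _root_.fderiv ℝ (fun _ : V3 => k) 0 w = 0
  simp

/-- The torus gradient of a constant vanishes. [folklore] -/
theorem torusGradient_const_apply (k : ℝ) (x : T3) : gradient (fun _ : T3 => k) x = 0 := by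
  change _root_.gradient (fun _ : V3 => k) 0 = 0
  simp

/-! ### The Landau–Teller law in convective form -/

/-- **Landau–Teller relaxation along particle paths.** For a two-temperature solution,
`∂ₜθ_rot + ⟪u, ∇θ_rot⟫ = ν (θ_tr - θ_rot)` with `ν = r · c(σ, ρ, θ_tr, θ_rot)` on `[0,T) × 𝕋³`: subtract
`θ_rot ×` the continuity equation from the rotational energy balance (Leibniz rules in `t` and `x`) and
divide by `(3/2)ρ > 0` — the rate equation `dT_rot/dt = ν (T_tr - T_rot)` transported by the flow.
[cite: HuthmannZippelius1997, eq. (17) of arXiv cond-mat/9708093] -/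
theorem rotTemperature_convective (h : IsLandauTellerEulerSolution σ r c T ρ u θtr θrot) {t : ℝ}
    (ht : t ∈ Ico 0 T) (x : T3) :
    timeDerivWithin (Ico 0 T) θrot t x + ⟪u t x, gradient (θrot t) x⟫_ℝ =
      r * c σ (ρ t x) (θtr t x) (θrot t x) * (θtr t x - θrot t x) := by
  have hS : UniqueDiffOn ℝ (Ico 0 T) := uniqueDiffOn_Ico 0 T
  have hρ1 : IsContDiff 1 (ρ t) := (h.smooth_density.isSmooth_slice ht).isContDiff (by simp)
  have hθ1 : IsContDiff 1 (θrot t) := (h.smooth_rotTemperature.isSmooth_slice ht).isContDiff (by simp)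
  have hu1 : IsContDiff 1 (u t) := (h.smooth_velocity.isSmooth_slice ht).isContDiff (by simp)
  have hE1 : IsContDiff 1 (fun y => rotationalEnergyDensity (ρ t y) (θrot t y)) := by
    unfold rotationalEnergyDensity
    exact (contDiff_const.mul hρ1).mul hθ1
  have hk1 : IsContDiff 1 (fun _ : T3 => (3 / 2 : ℝ)) := contDiff_const
  have hc1 : IsContDiff 1 (fun y => 3 / 2 * ρ t y) := contDiff_const.mul hρ1
  have hρ' := h.smooth_density.hasDerivWithinAt_slice ht x
  have hθ' := h.smooth_rotTemperature.hasDerivWithinAt_slice ht x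
  have hE' : timeDerivWithin (Ico 0 T) (fun s y => rotationalEnergyDensity (ρ s y) (θrot s y)) t x =
      3 / 2 * timeDerivWithin (Ico 0 T) ρ t x * θrot t x +
        3 / 2 * ρ t x * timeDerivWithin (Ico 0 T) θrot t x := by
    unfold rotationalEnergyDensity
    exact ((hρ'.const_mul (3 / 2)).mul hθ').derivWithin (hS t ht)
  have hdivE : divergence (fun y => rotationalEnergyDensity (ρ t y) (θrot t y) • u t y) x =
      3 / 2 * ρ t x * Torus.fderiv (θrot t) x (u t x) +
        θrot t x * (3 / 2 * Torus.fderiv (ρ t) x (u t x)) +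
        3 / 2 * ρ t x * θrot t x * divergence (u t) x := by
    rw [torusDivergence_smul_apply hE1 hu1]
    unfold rotationalEnergyDensity
    rw [torusFDeriv_mul_apply hc1 hθ1, torusFDeriv_mul_apply hk1 hρ1, torusFDeriv_const_apply]
    ring
  have hA := h.mass t ht x
  have hB := h.rotEnergy t ht x
  rw [torusDivergence_smul_apply hρ1 hu1] at hA
  rw [hE', hdivE, landauTellerExchange] at hB
  rw [real_inner_comm, Torus.inner_gradient_left]
  have hρ0 : (3 / 2 : ℝ) * ρ t x ≠ 0 := mul_ne_zero (by norm_num) (h.density_pos t ht x).ne'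
  exact mul_left_cancel₀ hρ0 (by linear_combination hB - 3 / 2 * θrot t x * hA)

/-- At `r = 0` the rotational temperature is **transported**: `∂ₜθ_rot + ⟪u, ∇θ_rot⟫ = 0` on
`[0,T) × 𝕋³`. [folklore] -/
theorem rotTemperature_transport (h : IsLandauTellerEulerSolution σ 0 c T ρ u θtr θrot) {t : ℝ}
    (ht : t ∈ Ico 0 T) (x : T3) :
    timeDerivWithin (Ico 0 T) θrot t x + ⟪u t x, gradient (θrot t) x⟫_ℝ = 0 := by
  simpa using h.rotTemperature_convective ht x

/-! ### Conservation of the total energy -/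

/-- **Total energy balance (every `r`).** The exchange terms cancel:
`∂ₜ(E_tr + E_rot) + [div((E_tr + p)u) + div(E_rot u)] = 0` on `[0,T) × 𝕋³` (the two flux divergences
kept separate: no spatial regularity of the pressure field is used). [folklore] -/
theorem totalEnergy_balance (h : IsLandauTellerEulerSolution σ r c T ρ u θtr θrot) {t : ℝ}
    (ht : t ∈ Ico 0 T) (x : T3) :
    timeDerivWithin (Ico 0 T) (fun s y => totalEnergyDensity (ρ s y) (u s y) (θtr s y) +
        rotationalEnergyDensity (ρ s y) (θrot s y)) t x +
      (divergence (fun y =>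
          (totalEnergyDensity (ρ t y) (u t y) (θtr t y) + hsPressure σ (ρ t y) (θtr t y)) • u t y) x +
        divergence (fun y => rotationalEnergyDensity (ρ t y) (θrot t y) • u t y) x) = 0 := by
  have hρ' := (h.smooth_density.hasDerivWithinAt_slice ht x).differentiableWithinAt
  have hu' := (h.smooth_velocity.hasDerivWithinAt_slice ht x).differentiableWithinAt
  have hθtr' := (h.smooth_trTemperature.hasDerivWithinAt_slice ht x).differentiableWithinAt
  have hθrot' := (h.smooth_rotTemperature.hasDerivWithinAt_slice ht x).differentiableWithinAt
  have hEtr : DifferentiableWithinAt ℝ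
      (fun s => totalEnergyDensity (ρ s x) (u s x) (θtr s x)) (Ico 0 T) t := by
    unfold totalEnergyDensity
    exact hρ'.mul (((hu'.norm_sq ℝ).div_const 2).add (hθtr'.const_mul _))
  have hErot : DifferentiableWithinAt ℝ
      (fun s => rotationalEnergyDensity (ρ s x) (θrot s x)) (Ico 0 T) t := by
    unfold rotationalEnergyDensity
    exact (hρ'.const_mul _).mul hθrot'
  have hsplit : timeDerivWithin (Ico 0 T) (fun s y => totalEnergyDensity (ρ s y) (u s y) (θtr s y) +
        rotationalEnergyDensity (ρ s y) (θrot s y)) t x =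
      timeDerivWithin (Ico 0 T) (fun s y => totalEnergyDensity (ρ s y) (u s y) (θtr s y)) t x +
        timeDerivWithin (Ico 0 T) (fun s y => rotationalEnergyDensity (ρ s y) (θrot s y)) t x :=
    derivWithin_fun_add hEtr hErot
  rw [hsplit]
  linear_combination h.trEnergy t ht x + h.rotEnergy t ht x

/-- **Conservation of total energy** in divergence form: if the pressure field
`y ↦ hsPressure σ (ρ t y) (θ_tr t y)` is `C¹` on `𝕋³` (true wherever the hard-sphere equation of state is
`C¹` on the range of the solution), then
`∂ₜ(E_tr + E_rot) + div((E_tr + E_rot + p)u) = 0` at time `t`, for every window parameter `r`.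
[folklore] -/
theorem totalEnergy (h : IsLandauTellerEulerSolution σ r c T ρ u θtr θrot) {t : ℝ} (ht : t ∈ Ico 0 T)
    (hp : IsContDiff 1 (fun y => hsPressure σ (ρ t y) (θtr t y))) (x : T3) :
    timeDerivWithin (Ico 0 T) (fun s y => totalEnergyDensity (ρ s y) (u s y) (θtr s y) +
        rotationalEnergyDensity (ρ s y) (θrot s y)) t x +
      divergence (fun y =>
        (totalEnergyDensity (ρ t y) (u t y) (θtr t y) + rotationalEnergyDensity (ρ t y) (θrot t y) +
          hsPressure σ (ρ t y) (θtr t y)) • u t y) x = 0 := by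
  have hρ1 : IsContDiff 1 (ρ t) := (h.smooth_density.isSmooth_slice ht).isContDiff (by simp)
  have hu1 : IsContDiff 1 (u t) := (h.smooth_velocity.isSmooth_slice ht).isContDiff (by simp)
  have hEtr1 : IsContDiff 1 (fun y => totalEnergyDensity (ρ t y) (u t y) (θtr t y)) := hρ1.mul
    (((hu1.norm_sq ℝ).div_const 2).add (contDiff_const.mul
      ((h.smooth_trTemperature.isSmooth_slice ht).isContDiff (n := 1) (by simp))))
  have hErot1 : IsContDiff 1 (fun y => rotationalEnergyDensity (ρ t y) (θrot t y)) :=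
    (contDiff_const.mul hρ1).mul ((h.smooth_rotTemperature.isSmooth_slice ht).isContDiff (by simp))
  have hEp1 : IsContDiff 1 (fun y => totalEnergyDensity (ρ t y) (u t y) (θtr t y) +
      hsPressure σ (ρ t y) (θtr t y)) := hEtr1.add hp
  have hEE1 : IsContDiff 1 (fun y => totalEnergyDensity (ρ t y) (u t y) (θtr t y) +
      rotationalEnergyDensity (ρ t y) (θrot t y)) := hEtr1.add hErot1
  have hsum1 : IsContDiff 1 (fun y => totalEnergyDensity (ρ t y) (u t y) (θtr t y) +
      rotationalEnergyDensity (ρ t y) (θrot t y) + hsPressure σ (ρ t y) (θtr t y)) :=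
    hEE1.add hp
  have hdiv : divergence (fun y =>
        (totalEnergyDensity (ρ t y) (u t y) (θtr t y) + rotationalEnergyDensity (ρ t y) (θrot t y) +
          hsPressure σ (ρ t y) (θtr t y)) • u t y) x =
      divergence (fun y =>
          (totalEnergyDensity (ρ t y) (u t y) (θtr t y) + hsPressure σ (ρ t y) (θtr t y)) • u t y) x +
        divergence (fun y => rotationalEnergyDensity (ρ t y) (θrot t y) • u t y) x := by
    rw [torusDivergence_smul_apply hsum1 hu1, torusDivergence_smul_apply hEp1 hu1,
      torusDivergence_smul_apply hErot1 hu1,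
      torusFDeriv_add_apply hEE1 hp, torusFDeriv_add_apply hEtr1 hErot1,
      torusFDeriv_add_apply hEtr1 hp]
    ring
  rw [hdiv]
  exact h.totalEnergy_balance ht x

/-- **Global equilibria are solutions (non-vacuity).** Constant states `ρ ≡ ρ₀ > 0`, `u ≡ u₀`,
`θ_tr ≡ θ_rot ≡ θ₀ > 0` solve the two-temperature system for every `σ`, `r`, `c`, `T` (all derivatives
vanish and the exchange term vanishes in equilibrium). [folklore] -/
theorem const (σ r : ℝ) (c : ℝ → ℝ → ℝ → ℝ → ℝ) (T : ℝ) {ρ₀ θ₀ : ℝ} (u₀ : V3) (hρ₀ : 0 < ρ₀)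
    (hθ₀ : 0 < θ₀) :
    IsLandauTellerEulerSolution σ r c T (fun _ _ => ρ₀) (fun _ _ => u₀) (fun _ _ => θ₀)
      (fun _ _ => θ₀) where
  smooth_density := contDiffOn_const
  smooth_velocity := contDiffOn_const
  smooth_trTemperature := contDiffOn_const
  smooth_rotTemperature := contDiffOn_const
  density_pos _ _ _ := hρ₀
  trTemperature_pos _ _ _ := hθ₀
  rotTemperature_pos _ _ _ := hθ₀
  mass t ht x := by simp [timeDerivWithin, divergence, partialDeriv, Torus.lineDeriv]
  momentum t ht x := by
    simp [timeDerivWithin, partialDeriv, Torus.lineDeriv, torusGradient_const_apply]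
  trEnergy t ht x := by simp [timeDerivWithin, divergence, partialDeriv, Torus.lineDeriv]
  rotEnergy t ht x := by simp [timeDerivWithin, divergence, partialDeriv, Torus.lineDeriv]

/-- **Homogeneous Landau–Teller relaxation** (non-vacuity with non-zero exchange; fixes the sign
conventions). For a constant rate function `c ≡ c₀` with `r c₀ ≥ 0`, the spatially homogeneous state
`ρ ≡ ρ₀ > 0`, `u ≡ u₀`, `θ_tr(t) = m + a e^{-2rc₀t}`, `θ_rot(t) = m - a e^{-2rc₀t}` (`|a| < m`) is a solution:
`θ_tr - θ_rot = 2a e^{-2νt}` decays at rate `2ν`, `ν = r c₀`, while `θ_tr + θ_rot` is conserved — the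
elastic (`ε = β = 1`) case of the two-temperature rate equations.
[cite: HuthmannZippelius1997, eqs. (16)–(17) of arXiv cond-mat/9708093] -/
theorem homogeneousRelaxation (σ r c₀ T : ℝ) {ρ₀ m a : ℝ} (u₀ : V3) (hρ₀ : 0 < ρ₀) (hma : |a| < m)
    (hrc : 0 ≤ r * c₀) :
    IsLandauTellerEulerSolution σ r (fun _ _ _ _ => c₀) T (fun _ _ => ρ₀) (fun _ _ => u₀)
      (fun t _ => m + a * Real.exp (-2 * (r * c₀) * t))
      (fun t _ => m - a * Real.exp (-2 * (r * c₀) * t)) := by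
  have hexp : ContDiff ℝ ((⊤ : ℕ∞) : WithTop ℕ∞) (fun p : ℝ × V3 => Real.exp (-2 * (r * c₀) * p.1)) :=
    Real.contDiff_exp.comp (contDiff_const.mul contDiff_fst)
  have hder : ∀ t, HasDerivAt (fun τ => Real.exp (-2 * (r * c₀) * τ))
      (-2 * (r * c₀) * Real.exp (-2 * (r * c₀) * t)) t := fun t => by
    simpa [mul_comm] using ((hasDerivAt_id t).const_mul (-2 * (r * c₀))).exp
  have hpos : ∀ t ∈ Ico (0 : ℝ) T, |a| * Real.exp (-2 * (r * c₀) * t) < m := fun t ht => by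
    have h1 : Real.exp (-2 * (r * c₀) * t) ≤ 1 := Real.exp_le_one_iff.2 (by nlinarith [ht.1])
    nlinarith [abs_nonneg a, Real.exp_pos (-2 * (r * c₀) * t)]
  refine
    { smooth_density := contDiffOn_const
      smooth_velocity := contDiffOn_const
      smooth_trTemperature := (contDiff_const.add (contDiff_const.mul hexp)).contDiffOn
      smooth_rotTemperature := (contDiff_const.sub (contDiff_const.mul hexp)).contDiffOn
      density_pos := fun _ _ _ => hρ₀
      trTemperature_pos := fun t ht _ => ?_
      rotTemperature_pos := fun t ht _ => ?_
      mass := fun t ht x => by simp [timeDerivWithin, divergence, partialDeriv, Torus.lineDeriv]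
      momentum := fun t ht x => by
        simp [timeDerivWithin, partialDeriv, Torus.lineDeriv, torusGradient_const_apply]
      trEnergy := fun t ht x => ?_
      rotEnergy := fun t ht x => ?_ }
  · have h2 : -(|a| * Real.exp (-2 * (r * c₀) * t)) ≤ a * Real.exp (-2 * (r * c₀) * t) := by
      rw [← neg_mul]; exact mul_le_mul_of_nonneg_right (neg_abs_le a) (Real.exp_pos _).le
    linarith [hpos t ht]
  · have h2 : a * Real.exp (-2 * (r * c₀) * t) ≤ |a| * Real.exp (-2 * (r * c₀) * t) :=
      mul_le_mul_of_nonneg_right (le_abs_self a) (Real.exp_pos _).le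
    linarith [hpos t ht]
  · have hE : HasDerivWithinAt (fun τ => totalEnergyDensity ρ₀ u₀ (m + a * Real.exp (-2 * (r * c₀) * τ)))
        (ρ₀ * (3 / 2 * (a * (-2 * (r * c₀) * Real.exp (-2 * (r * c₀) * t))))) (Ico 0 T) t := by
      unfold totalEnergyDensity
      exact ((((hder t).const_mul a).const_add m).const_mul (3 / 2) |>.const_add
        (‖u₀‖ ^ 2 / 2)).const_mul ρ₀ |>.hasDerivWithinAt
    simp only [timeDerivWithin, divergence, partialDeriv, Torus.lineDeriv, landauTellerExchange]
    rw [hE.derivWithin (uniqueDiffOn_Ico (0 : ℝ) T t ht)]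
    simp; ring
  · have hE : HasDerivWithinAt (fun τ => rotationalEnergyDensity ρ₀ (m - a * Real.exp (-2 * (r * c₀) * τ)))
        (3 / 2 * ρ₀ * (-(a * (-2 * (r * c₀) * Real.exp (-2 * (r * c₀) * t))))) (Ico 0 T) t := by
      unfold rotationalEnergyDensity
      exact (((hder t).const_mul a).const_sub m).const_mul (3 / 2 * ρ₀) |>.hasDerivWithinAt
    simp only [timeDerivWithin, divergence, partialDeriv, Torus.lineDeriv, landauTellerExchange]
    rw [hE.derivWithin (uniqueDiffOn_Ico (0 : ℝ) T t ht)]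
    simp; ring

end IsLandauTellerEulerSolution

end Literature.MathematicalPhysics.KineticTheory

end
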